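import Summits.HodgeConjecture.HodgeConjecture.Theorems.K2E3OrbitClosureHermitianPairs
import Summits.HodgeConjecture.HodgeConjecture.Theorems.K2E3OrbitClosureSemisimpleTransport
import Mathlib.LinearAlgebra.Matrix.ToLin
import Mathlib.LinearAlgebra.Matrix.NonsingularInverse
import HarnessLib

/-!
# K2 ∕ E3 «EllipticInputs», unit U12 — helper file for socket #10 `sig_K2E3OrbitClosureContainsSemisimple`:
# the compression of an isometry along a hyperbolic frame (`g|_U`, non-degeneracy of `U`, the `W'`-block `d = ((a^σ)ᵀ)⁻¹`)

Cell `hodgecm-mathlib` (Track B «K2-LIT»), item h413 = `stmt-HodgeConjecture-24833`; author K2E3-p10 (g0).  PROOF lane (theorems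
only, no `sorry`).  Continues ★ `K2E3OrbitClosureHermitianPairs`: `h : V →ₛₗ[σ] V →ₗ[K] K` hermitian non-degenerate, `g` an isometry,
`W` a `g`-stable TOTALLY ISOTROPIC subspace with basis `(w_i)`, hyperbolic partners `(w'_i)` and `U = {v | h(w_i,v) = h(w'_i,v) = 0}`.

* `exists_compression` — the compression `g_U u := g u − Σ_i h(w'_i, g u) w_i` is an isometry of `(U, h|_U)` (the Levi component of
  `g` in the parabolic stabilising `W`); `nondegenerate_restrict` — `h|_U` is non-degenerate; `finrank_lt_of_frame` — `dim U < dim V`;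
* `isSemisimple_wBlock` — the `W'`-block `D_{l'l} = h(w_{l'}, g w'_l)` of `g` satisfies `((A^σ)ᵀ) · D = 1` for the matrix `A` of `g|_W`,
  hence is semisimple when `g|_W` is (★ transport lemmas: inverse, transpose, `σ`-map);
* `repr_sum_inl` ∕ `repr_sum_inr_inl` ∕ `repr_sum_inr_inr` — coordinates of vectors supported on one block of a basis indexed by
  `ι ⊕ (κ ⊕ ι')`.

References: J. Dieudonné, *La géométrie des groupes classiques* (1971), Ch. I §11; folklore.
-/

set_option autoImplicit false
set_option linter.dupNamespace false

namespace Summit.HodgeConjecture.HodgeConjecture.Cruxes.H413.K2E3OrbitClosureHermitianCompression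

open Module Module.End K2E3OrbitClosureHermitianPairs
open scoped Matrix

/-! ## §1 Coordinates of block-supported vectors -/

section Repr

variable {K : Type*} [Field K] {V : Type*} [AddCommGroup V] [Module K V]
  {ι κ ι' : Type*} [Fintype ι] [Fintype κ] [Fintype ι'] (b : Basis (ι ⊕ (κ ⊕ ι')) K V)

/-- Coordinates of a combination of the first block. [folklore] -/
theorem repr_sum_inl (c : ι → K) (k : ι ⊕ (κ ⊕ ι')) :
    b.repr (∑ i, c i • b (Sum.inl i)) k = Sum.elim c (fun _ => 0) k := by
  have := b.repr_sum_self (Sum.elim c (fun _ => 0))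
  rw [Fintype.sum_sum_type] at this
  simp only [Sum.elim_inl, Sum.elim_inr, zero_smul, Finset.sum_const_zero, add_zero] at this
  rw [this]

/-- Coordinates of a combination of the middle block. [folklore] -/
theorem repr_sum_inr_inl (c : κ → K) (k : ι ⊕ (κ ⊕ ι')) :
    b.repr (∑ j, c j • b (Sum.inr (Sum.inl j))) k = Sum.elim (fun _ => 0) (Sum.elim c (fun _ => 0)) k := by
  have := b.repr_sum_self (Sum.elim (fun _ => 0) (Sum.elim c (fun _ => 0)))
  rw [Fintype.sum_sum_type, Fintype.sum_sum_type] at this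
  simp only [Sum.elim_inl, Sum.elim_inr, zero_smul, Finset.sum_const_zero, add_zero, zero_add] at this
  rw [this]

/-- Coordinates of a combination of the last block. [folklore] -/
theorem repr_sum_inr_inr (c : ι' → K) (k : ι ⊕ (κ ⊕ ι')) :
    b.repr (∑ l, c l • b (Sum.inr (Sum.inr l))) k = Sum.elim (fun _ => 0) (Sum.elim (fun _ => 0) c) k := by
  have := b.repr_sum_self (Sum.elim (fun _ => 0) (Sum.elim (fun _ => 0) c))
  rw [Fintype.sum_sum_type, Fintype.sum_sum_type] at this
  simp only [Sum.elim_inl, Sum.elim_inr, zero_smul, Finset.sum_const_zero, zero_add] at this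
  rw [this]

end Repr

/-! ## §2 The compression along a hyperbolic frame -/

section Frame

variable {K : Type*} [Field K] {σ : K →+* K} {V : Type*} [AddCommGroup V] [Module K V]
  (h : V →ₛₗ[σ] V →ₗ[K] K) (hherm : ∀ x y, h y x = σ (h x y))
  {g : Module.End K V} (hg : ∀ x y, h (g x) (g y) = h x y)
  {W : Submodule K V} (hgW : W.map g = W) (hWiso : ∀ x ∈ W, ∀ y ∈ W, h x y = 0)
  {ι : Type*} [Fintype ι] [DecidableEq ι] (bW : Basis ι K W)
  (w' : ι → V) (hww' : ∀ i j, h (bW i) (w' j) = if i = j then 1 else 0) (hw'w' : ∀ i j, h (w' i) (w' j) = 0)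
  {U : Submodule K V} (hU : ∀ v, v ∈ U ↔ (∀ i, h (bW i) v = 0) ∧ ∀ i, h (w' i) v = 0)

include hg hgW hU in
omit [DecidableEq ι] in
/-- `g u` stays orthogonal to `W` for `u ∈ U` (`W = g W` and `g` is an isometry). [folklore] -/
theorem apply_w_g_eq_zero (i : ι) (u : U) : h (bW i) (g u) = 0 := by
  have hmem : (bW i : V) ∈ W.map g := by rw [hgW]; exact (bW i).2
  obtain ⟨x, hx, hxe⟩ := Submodule.mem_map.1 hmem
  rw [← hxe, hg]
  exact (forall_mem_apply_eq_zero_iff h bW (u : V)).2 ((hU u).1 u.2).1 x hx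

include hherm hg hgW hWiso hww' hU in
/-- **The compression** `g_U u = g u − Σ_i h(w'_i, g u) w_i` is an endomorphism of `U` and an isometry of `h|_U`. [folklore] -/
theorem exists_compression :
    ∃ gU : Module.End K U, (∀ u : U, (gU u : V) = g u - ∑ i, h (w' i) (g u) • (bW i : V)) ∧
      ∀ u u' : U, h (gU u) (gU u') = h u u' := by
  have hw'w : ∀ i j, h (w' i) (bW j) = if j = i then 1 else 0 := fun i j => by
    rw [hherm, hww']; split_ifs <;> simp
  have hww : ∀ i j, h (bW i) (bW j) = 0 := fun i j => hWiso _ (bW i).2 _ (bW j).2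
  let f : U →ₗ[K] V := g ∘ₗ U.subtype - ∑ i, LinearMap.smulRight ((h (w' i)).comp (g ∘ₗ U.subtype)) (bW i : V)
  have hf : ∀ u : U, f u = g u - ∑ i, h (w' i) (g u) • (bW i : V) := fun u => by
    simp [f, LinearMap.sum_apply, LinearMap.smulRight_apply]
  have hfmem : ∀ u : U, f u ∈ U := by
    intro u
    rw [hU, hf]
    refine ⟨fun k => ?_, fun k => ?_⟩
    · rw [map_sub, apply_sum_smul_right, apply_w_g_eq_zero h hg hgW bW w' hU k u]
      simp [hww]
    · rw [map_sub, apply_sum_smul_right]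
      simp [hw'w]
  refine ⟨LinearMap.codRestrict U f hfmem, fun u => hf u, fun u u' => ?_⟩
  change h (f u) (f u') = h u u'
  rw [hf, hf, map_sub h, LinearMap.sub_apply, map_sub, map_sub, apply_sum_smul_right, apply_sum_smul_left,
    apply_sum_smul_left, hg]
  have h1 : ∀ i, h (g u) (bW i) = 0 := fun i => by
    rw [apply_eq_zero_comm h hherm]; exact apply_w_g_eq_zero h hg hgW bW w' hU i u
  simp [h1, apply_w_g_eq_zero h hg hgW bW w' hU _ u', hww]

include hherm hWiso hww' hw'w' hU in
/-- **`h|_U` is non-degenerate** (every `v` is `Σ h(w'_i,v) w_i + u + Σ h(w_i,v) w'_i` with `u ∈ U`). [folklore] -/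
theorem nondegenerate_restrict [FiniteDimensional K V] (hnd : ∀ x, (∀ y, h x y = 0) → x = 0) (x : U)
    (hx : ∀ y : U, h x y = 0) : x = 0 := by
  obtain ⟨-, -, -, -, -, -, hprU, -⟩ := exists_adapted_basis h hherm hWiso bW w' hww' hw'w' hU (Module.finBasis K U)
  apply Subtype.ext
  refine hnd _ fun v => ?_
  have hv : v = (v - ∑ i, h (w' i) v • (bW i : V) - ∑ i, h (bW i) v • w' i) +
      (∑ i, h (w' i) v • (bW i : V) + ∑ i, h (bW i) v • w' i) := by abel
  have hxw : ∀ i, h x (bW i) = 0 := fun i => by rw [apply_eq_zero_comm h hherm]; exact ((hU x).1 x.2).1 i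
  have hxw' : ∀ i, h x (w' i) = 0 := fun i => by rw [apply_eq_zero_comm h hherm]; exact ((hU x).1 x.2).2 i
  rw [hv, map_add, map_add, hx ⟨_, hprU v⟩, apply_sum_smul_right, apply_sum_smul_right]
  simp [hxw, hxw']

include hww' hU in
omit [Fintype ι] in
/-- `dim U < dim V` (`w'_i ∉ U`). [folklore] -/
theorem finrank_lt_of_frame [FiniteDimensional K V] (i : ι) : finrank K U < finrank K V := by
  refine Submodule.finrank_lt fun htop => ?_
  have : w' i ∈ U := by rw [htop]; exact Submodule.mem_top
  have h1 := ((hU _).1 this).1 i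
  rw [hww', if_pos rfl] at h1
  exact one_ne_zero h1

include hg hww' in
/-- **The `W'`-block is `((A^σ)ᵀ)⁻¹`**: with `A` the matrix of `g|_W` in the basis `(w_i)` and `D_{l'l} = h(w_{l'}, g w'_l)`,
`(A^σ)ᵀ · D = 1` (pair `g w_i = Σ A_{l'i} w_{l'}` with `g w'_l`: `h(g w_i, g w'_l) = h(w_i, w'_l) = δ_{il}`). [folklore] -/
theorem map_transpose_mul_wBlock_eq_one (hW : W ∈ g.invtSubmodule) :
    ((LinearMap.toMatrix bW bW (g.restrict hW)).map σ)ᵀ * Matrix.of (fun l' l => h (bW l') (g (w' l))) = 1 := by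
  ext i l
  rw [Matrix.mul_apply, Matrix.one_apply]
  simp only [Matrix.transpose_apply, Matrix.map_apply, Matrix.of_apply, LinearMap.toMatrix_apply]
  have hexp : (g (bW i) : V) = ∑ l', bW.repr (g.restrict hW (bW i)) l' • (bW l' : V) := by
    rw [← coe_eq_sum_repr bW (g.restrict hW (bW i))]
    rfl
  rw [← apply_sum_smul_left h Finset.univ (fun l' => bW.repr (g.restrict hW (bW i)) l') (fun l' => (bW l' : V)) (g (w' l)),
    ← hexp, hg, hww']

include hg hww' in
/-- **The `W'`-block is semisimple when `g|_W` is** (`σ` an involution). [folklore] -/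
theorem isSemisimple_wBlock (hσ : ∀ a, σ (σ a) = a) (hW : W ∈ g.invtSubmodule)
    (hss : Module.End.IsSemisimple (g.restrict hW)) :
    Module.End.IsSemisimple (Matrix.toLin' (Matrix.of fun l' l => h (bW l') (g (w' l)))) := by
  set A := LinearMap.toMatrix bW bW (g.restrict hW) with hA
  set D : Matrix ι ι K := Matrix.of fun l' l => h (bW l') (g (w' l)) with hD
  have hCD : (A.map σ)ᵀ * D = 1 := map_transpose_mul_wBlock_eq_one h hg bW w' hww' hW
  have hCunit : IsUnit ((A.map σ)ᵀ).det := Matrix.isUnit_det_of_right_inverse hCD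
  rw [← Matrix.inv_eq_right_inv hCD, K2E3OrbitClosureSemisimpleTransport.isSemisimple_toLin'_inv_iff hCunit,
    K2E3OrbitClosureSemisimpleTransport.isSemisimple_toLin'_transpose_iff,
    K2E3OrbitClosureSemisimpleTransport.isSemisimple_toLin'_map_iff σ (Function.Involutive.bijective hσ)]
  -- `toLin' A` is conjugate to `g|_W` by the coordinate isomorphism of `bW`
  refine (LinearEquiv.isSemisimple_iff (g.restrict hW) (Matrix.toLin' A) bW.equivFun ?_).1 hss
  apply LinearMap.ext
  intro x
  change bW.equivFun (g.restrict hW x) = Matrix.toLin' A (bW.equivFun x)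
  rw [Matrix.toLin'_apply, Basis.equivFun_apply, Basis.equivFun_apply, hA,
    LinearMap.toMatrix_mulVec_repr bW bW (g.restrict hW) x]

end Frame

end Summit.HodgeConjecture.HodgeConjecture.Cruxes.H413.K2E3OrbitClosureHermitianCompression
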